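import Summits.BirchSwinnertonDyer.BirchSwinnertonDyer.Theorems.ByReductionTypeAtTwoAdditiveRankZeroResidualV11
import Summits.BirchSwinnertonDyer.BirchSwinnertonDyer.Theorems.ByReductionTypeAtTwoAdditiveKatoDescentSocketDefs
import Summits.BirchSwinnertonDyer.BirchSwinnertonDyer.Theorems.ByReductionTypeAtTwoAdditiveKatoDescentSocketDoors
import HarnessLib

/-!
# Crux `AdditiveRankZeroAtTwo` (K4 item 19098): the crux BY NAME from its one-sided residual, v12 — the four split-twist block
# TARGETS of v11 (`h₁ h₂ hR₁ hR₂`) REPLACED by their DESCENT SOCKETS + the Literature CONSTRUCTION fact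
# `Kato2004.exists_splitTwistDivisibilityInputsDescent_negOne_two` + PRINT ×4 (`Kato2004.thm12_4`, Greenberg Thm. 1.14 over `ℚ` and over
# the quadratic field, Greenberg Thm. 1.5); the doors «socket + (IW_d) ⟹ target» that make the replacement (theorems only)

Cell `bsd-2adic`, rung K4, crux stmt-BirchSwinnertonDyer-19098, split v2.2 (children C1″ 22615, C2″ 22616, C3″ 22617, C4″ 22618, C5‴ 22619,
glue 22620). Seat `bsd-2adic-addL2x` GEN 18 (repair-census entry R-B81 «descent socket», part 3 of 3; sequel of k4-w3 GEN 0's v11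
p685citation `additiveRankZeroAtTwo_of_residual_v11`). `--supports` helper of the GLUE item 22620. HONEST FRAMING (D-0036/D-0054): an
assembly-shaped CONDITIONAL theorem; every research-grade input is displayed; closes nothing at the `∀`-level; nothing booked; BSD is not
proved by any of this. NO restate of the executed split is asked (record for the planner; D-0152).

WHAT v12 CHANGES (versus v11). On the four split-twist sub-blocks of the potentially multiplicative additive curves ((−1)-split 169 classes,
(−2)-split 39; irreducible / reducible `E[2]`) v11 takes the block TARGETS `h₁ = KatoSharpAtTwoAdditiveNegOneSplitTwist`,
`h₂ = …NegTwo…`, `hR₁ = KatoMemberSharpAtTwoAdditiveNegOneSplitTwistReducible`, `hR₂ = …NegTwo…Reducible` WHOLE — `@[conjecture]` constants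
whose docstrings call them «reading-grade modulo the odd-branch package». v12 takes instead their SOCKETS `hS₁ hS₂ hSR₁ hSR₂`
(`KatoDescentSocketAtTwoAdditiveNeg{One,Two}SplitTwist{,Reducible}`, `…AdditiveKatoDescentSocketDefs.lean`: the target with the Iwasawa-level
input (IW_d) as a hypothesis — content = the descent reading T1–T14 / R1–R13·R12♯ + T22) and DERIVES (IW_d) from the Literature
construction fact `hDesc` + PRINT {`h12`, `h114`, `h114F`, `h15`, `hmod`} by the cell's END theorems in `W`-only form
(`katoDivisibility_neg{One,Two}SplitTwist_two_of_descent_of_L_one_ne_zero`, `…AdditiveKatoDescentSocketDoors.lean`). §0 = target ⟹ socket ×4 (no hidden strengthening);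
§1 = the four doors «socket ⟹ target»; §2 = v12; §3 = v11's targets ⟹ v12's sockets, the children by name.

Inputs of `additiveRankZeroAtTwo_of_residual_v12`: PRINT {`hGZK`, `hmod`, `hmodN`, `hLim2`, `hFW`, `hCassels`, `hCT`, `h12`, `h114`, `h114F`,
`h15`} + Literature CONSTRUCTION fact {`hDesc` (p724228, review-accepted, audit-2 hDescTw PASS)} + READINGS {`hNST2` (D-audit PASS), `hinS`
(hMHnst@2 + R12♯), `hS₁`, `hS₂`, `hSR₁`, `hSR₂` (Summits MEMO-tier descent sockets)} + research `∀`-objects {C1″ `hAna`, C3″ `hLow`,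
(I1M′) `hAnaMI`, (I3M) `hLowM`}. So on the whole ADDITIVE block the residual reads
**{(A) on the `S₃`-image curves (C1″ ∪ I1M′), the LOWER half over `ℚ` (C3″ ∪ I3M)} modulo {2 Literature readings, 4 descent sockets,
1 Literature construction fact, PRINT}** — NO block target, NO object-level `@[conjecture]` input at `2`.

AUDIT RECORD (audit-2 GEN 68, sheet hT22 @4445dc0da018d3ad PASS + ADDENDUM-1 @cfbd273b98895ae3; pen RC-488 «PRICE-T22-SOCKETS»): the four
sockets are READING @2 (PRINT-COMPOSITE + BRIDGED), `@[conjecture]` by RC-307 (β); doc-only N1 recorded here (the Defs door is append-only):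
(R1) in T22 (a)(β) the length `ℓ_{𝔮₀}(P⁻/Λ'·loc z̃) = 1 + ord_{𝔮₀} L⁻` holds for EITHER isomorphism type of `0 → (U⁻)_{𝔮₀} → (P⁻)_{𝔮₀} → Λ'/𝔮₀ → 0`
— freeness of `(P⁻)_{𝔮₀}` (true, by Coleman: the augmentation of the Coleman measure of `((1−ζ⁵)/(1−ζ))_n` is `½·log₂ 5 ≠ 0`) is not
used; only `ℓ_{𝔮₀}(𝐇'²_loc) ≤ 1` (12.5 (3)) enters the inequality (R2); (R4) the W-only END door named in the sockets' docstrings is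
`katoDivisibility_negOneSplitTwist_two_of_descent_of_L_one_ne_zero` (p735673, this file's §1 input); and Conj. 12.10 (p. 224) carries its
own `p = 2` clause «In the case p = 2, assume 𝔭 does not contain 2» — `𝔮₀ ∌ 2` is inside the printed scope.

References: [Kato2004Asterisque] Thm. 12.4 (p. 221), Thm. 12.5 (3)(4), (12.5.1) (p. 222), Thm. 12.6 (p. 222), Conj. 12.10 (p. 224), 13.13,
§14.8, §14.14, Prop. 14.16 (2) (pp. 238–245), Lemma 17.12, §17.13 (pp. 278–280); [GreenbergLNM1716] Thm. 1.5, Thm. 1.14, §2;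
[MazurTateTeitelbaum1986Invent] §I.17; [MazurRubin2004] Thm. 2.3.4; [SilvermanATAEC1994] V.5.3, Ex. 5.11; [CoatesSujatha2005] statement (A);
[Lim2017FineSelmer] Thm. 3.5; [FerreroWashington1979]; [Cassels1965ArithmeticVIII]; [SilvermanAEC2009] X.4.14; [Miller2011LMS] Def. 1.1;
memo `run/shared/lean/pub/bsd-2adic/addL2x/VERDICT-19098-addL2x-GEN18.md`.
-/

set_option autoImplicit false
set_option linter.dupNamespace false

noncomputable section

open scoped Classical

namespace Summit.BirchSwinnertonDyer.BirchSwinnertonDyer.Theorems.AddKatoTwo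

open WeierstrassCurve Literature.NumberTheory.EllipticCurves
  Literature.NumberTheory.EllipticCurves.ModularForms
  Literature.NumberTheory.EllipticCurves.Kato2004
  Literature.NumberTheory.EllipticCurves.Greenberg1999
  Literature.NumberTheory.EllipticCurves.Rank1Residual
  Literature.NumberTheory.EllipticCurves.Rank1Residual.Typed
  Literature.NumberTheory.IwasawaTheory
  Summit.BirchSwinnertonDyer.Rank1Residual Summit.BirchSwinnertonDyer.Rank1Residual.AdditivePotMult
  Summit.BirchSwinnertonDyer.Rank1Residual.X5.AddTwoL2
  Summit.BirchSwinnertonDyer.BirchSwinnertonDyer.Theses.ByReductionTypeAtTwo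
  Summit.BirchSwinnertonDyer.BirchSwinnertonDyer.Theorems.SemistableKatoTwo

/-! ## §0 Pure logic: the sockets are WEAKER than the block targets they replace (no hidden strengthening) -/

/-- **Target ⟹ socket, (−1) irreducible block** (the socket only adds a hypothesis). Recorded so the planner sees v12 asks nothing
beyond v11 on this block (the socket constants live in `…AdditiveKatoDescentSocketDefs.lean`, Literature-only imports). [cite: Kato2004Asterisque, Conj. 12.10 (p. 224)] -/
theorem katoDescentSocketAtTwoAdditiveNegOneSplitTwist_of_target (h₁ : KatoSharpAtTwoAdditiveNegOneSplitTwist) :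
    KatoDescentSocketAtTwoAdditiveNegOneSplitTwist :=
  fun W _ _ hcm hgood hmult hsp hirr hA hL hfin _ ↦ h₁ W hcm hgood hmult hsp hirr hA hL hfin

/-- **Target ⟹ socket, (−2) irreducible block.** [cite: Kato2004Asterisque, Conj. 12.10 (p. 224)] -/
theorem katoDescentSocketAtTwoAdditiveNegTwoSplitTwist_of_target (h₂ : KatoSharpAtTwoAdditiveNegTwoSplitTwist) :
    KatoDescentSocketAtTwoAdditiveNegTwoSplitTwist :=
  fun W _ _ hcm hgood hmult hsp hirr hA hL hfin _ ↦ h₂ W hcm hgood hmult hsp hirr hA hL hfin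

/-- **Target ⟹ socket, (−1) member (reducible) block.** [cite: Kato2004Asterisque, Conj. 12.10 (p. 224)] -/
theorem katoDescentSocketAtTwoAdditiveNegOneSplitTwistReducible_of_target
    (hR₁ : KatoMemberSharpAtTwoAdditiveNegOneSplitTwistReducible) :
    KatoDescentSocketAtTwoAdditiveNegOneSplitTwistReducible :=
  fun W _ _ hcm hgood hmult hsp hred hL hfin _ ↦ hR₁ W hcm hgood hmult hsp hred hL hfin

/-- **Target ⟹ socket, (−2) member (reducible) block.** [cite: Kato2004Asterisque, Conj. 12.10 (p. 224)] -/
theorem katoDescentSocketAtTwoAdditiveNegTwoSplitTwistReducible_of_target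
    (hR₂ : KatoMemberSharpAtTwoAdditiveNegTwoSplitTwistReducible) :
    KatoDescentSocketAtTwoAdditiveNegTwoSplitTwistReducible :=
  fun W _ _ hcm hgood hmult hsp hred hL hfin _ ↦ hR₂ W hcm hgood hmult hsp hred hL hfin

/-! ## §1 The doors: socket + (IW_d) from the construction fact ⟹ the block target -/

/-- **The (−1) irreducible block target from its socket**: `KatoSharpAtTwoAdditiveNegOneSplitTwist ⟸ {socket `hS₁`, `Kato2004.thm12_4`,
the construction fact `hDesc`, Greenberg 1.14 ×2, Greenberg 1.5, modularity}` — (IW₋₁) is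
`katoDivisibility_negOneSplitTwist_two_of_descent_of_L_one_ne_zero`. [cite: Kato2004Asterisque, Conj. 12.10 (p. 224), §17.13 (pp. 279–280)]
[cite: GreenbergLNM1716, Thm. 1.5 (p. 61), Thm. 1.14 (p. 68)] -/
theorem katoSharpAtTwoAdditiveNegOneSplitTwist_of_socket (hS₁ : KatoDescentSocketAtTwoAdditiveNegOneSplitTwist) (h12 : Kato2004.thm12_4)
    (hDesc : Kato2004.exists_splitTwistDivisibilityInputsDescent_negOne_two) (h114 : Greenberg1999_thm114_charIdeal_iota_invariant)
    (h114F : thm114_charIdeal_iota_invariant_splitMult_baseChange) (h15 : thm15_isTorsion_multiplicative_rat)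
    (hmod : hasEntireLFunction_rat) : KatoSharpAtTwoAdditiveNegOneSplitTwist :=
  fun W _ _ hcm hgood hmult hsp hirr hA hL hfin ↦ hS₁ W hcm hgood hmult hsp hirr hA hL hfin
    (by
      intro κ γ hκ hγ hγ' N _ f hf
      exact katoDivisibility_negOneSplitTwist_two_of_descent_of_L_one_ne_zero h12 hDesc h114 h114F h15 hmod W hsp hL κ γ hκ hγ
        hγ' f hf)

/-- **The (−2) irreducible block target from its socket** (k4-w3's END p728952 in `W`-only form supplies (IW₋₂)).
[cite: Kato2004Asterisque, Conj. 12.10 (p. 224), §17.13 (pp. 279–280)] [cite: GreenbergLNM1716, Thm. 1.5 (p. 61), Thm. 1.14 (p. 68)] -/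
theorem katoSharpAtTwoAdditiveNegTwoSplitTwist_of_socket (hS₂ : KatoDescentSocketAtTwoAdditiveNegTwoSplitTwist) (h12 : Kato2004.thm12_4)
    (hDesc : Kato2004.exists_splitTwistDivisibilityInputsDescent_negOne_two) (h114 : Greenberg1999_thm114_charIdeal_iota_invariant)
    (h114F : thm114_charIdeal_iota_invariant_splitMult_baseChange) (h15 : thm15_isTorsion_multiplicative_rat)
    (hmod : hasEntireLFunction_rat) : KatoSharpAtTwoAdditiveNegTwoSplitTwist :=
  fun W _ _ hcm hgood hmult hsp hirr hA hL hfin ↦ hS₂ W hcm hgood hmult hsp hirr hA hL hfin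
    (by
      intro κ γ hκ hγ hγ' N _ f hf
      exact katoDivisibility_negTwoSplitTwist_two_of_descent_of_L_one_ne_zero h12 hDesc h114 h114F h15 hmod W hsp hL κ γ hκ hγ
        hγ' f hf)

/-- **The (−1) member (reducible) block target from its socket.** [cite: Kato2004Asterisque, Conj. 12.10 (p. 224), Prop. 14.16 (2) (pp. 244–245)]
[cite: GreenbergLNM1716, Thm. 1.5 (p. 61), Thm. 1.14 (p. 68)] -/
theorem katoMemberSharpAtTwoAdditiveNegOneSplitTwistReducible_of_socket
    (hSR₁ : KatoDescentSocketAtTwoAdditiveNegOneSplitTwistReducible) (h12 : Kato2004.thm12_4)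
    (hDesc : Kato2004.exists_splitTwistDivisibilityInputsDescent_negOne_two) (h114 : Greenberg1999_thm114_charIdeal_iota_invariant)
    (h114F : thm114_charIdeal_iota_invariant_splitMult_baseChange) (h15 : thm15_isTorsion_multiplicative_rat)
    (hmod : hasEntireLFunction_rat) : KatoMemberSharpAtTwoAdditiveNegOneSplitTwistReducible :=
  fun W _ _ hcm hgood hmult hsp hred hL hfin ↦ hSR₁ W hcm hgood hmult hsp hred hL hfin
    (by
      intro κ γ hκ hγ hγ' N _ f hf
      exact katoDivisibility_negOneSplitTwist_two_of_descent_of_L_one_ne_zero h12 hDesc h114 h114F h15 hmod W hsp hL κ γ hκ hγ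
        hγ' f hf)

/-- **The (−2) member (reducible) block target from its socket.** [cite: Kato2004Asterisque, Conj. 12.10 (p. 224), Prop. 14.16 (2) (pp. 244–245)]
[cite: GreenbergLNM1716, Thm. 1.5 (p. 61), Thm. 1.14 (p. 68)] -/
theorem katoMemberSharpAtTwoAdditiveNegTwoSplitTwistReducible_of_socket
    (hSR₂ : KatoDescentSocketAtTwoAdditiveNegTwoSplitTwistReducible) (h12 : Kato2004.thm12_4)
    (hDesc : Kato2004.exists_splitTwistDivisibilityInputsDescent_negOne_two) (h114 : Greenberg1999_thm114_charIdeal_iota_invariant)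
    (h114F : thm114_charIdeal_iota_invariant_splitMult_baseChange) (h15 : thm15_isTorsion_multiplicative_rat)
    (hmod : hasEntireLFunction_rat) : KatoMemberSharpAtTwoAdditiveNegTwoSplitTwistReducible :=
  fun W _ _ hcm hgood hmult hsp hred hL hfin ↦ hSR₂ W hcm hgood hmult hsp hred hL hfin
    (by
      intro κ γ hκ hγ hγ' N _ f hf
      exact katoDivisibility_negTwoSplitTwist_two_of_descent_of_L_one_ne_zero h12 hDesc h114 h114F h15 hmod W hsp hL κ γ hκ hγ
        hγ' f hf)

/-! ## §2 The crux BY NAME, v12 — sockets + construction fact + PRINT in place of the four block targets -/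

/-- **The crux `AdditiveRankZeroAtTwo` (item stmt-BirchSwinnertonDyer-19098; type = the route decl verbatim) from its ONE-SIDED,
SIBLING-FREE residual, v12 — NO block target.** Inputs: PRINT {`hGZK`, `hmod`, `hmodN`, `hLim2`, `hFW`, `hCassels`, `hCT`, `h12` (Kato
Thm. 12.4), `h114`/`h114F` (Greenberg Thm. 1.14 over `ℚ` / over the quadratic field at a split multiplicative prime), `h15` (Greenberg
Thm. 1.5)} + the Literature CONSTRUCTION fact `hDesc` (`Kato2004.exists_splitTwistDivisibilityInputsDescent_negOne_two`: the odd-branch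
§17.13 descent package at `2`) + READINGS {`hNST2`, `hinS` (Literature), `hS₁`, `hS₂`, `hSR₁`, `hSR₂` (the descent sockets of
`…AdditiveKatoDescentSocketDefs.lean`)} + research `∀`-objects {C1″ `hAna`, C3″ `hLow`, (I1M′) `hAnaMI`, (I3M) `hLowM`} — v11's statement
with `h₁ h₂ hR₁ hR₂` replaced by {sockets, `h12`, `hDesc`, `h114`, `h114F`, `h15`}; proof = v11 ∘ the four doors of §1. Conditional
(audit `proof.conditional`); the item is NOT closed.
[cite: Kato2004Asterisque, Thm. 12.4 (p. 221), Thm. 12.5 (3) and (12.5.1) (p. 222), Conj. 12.10 (p. 224), 13.13 (p. 233), Thm. 12.6 (p. 222), §14.8 (p. 238), §14.14 (p. 243), Prop. 14.16 (2) and its proof (pp. 244–245), Lemma 17.12 (pp. 278–279), §17.13 (pp. 279–280)]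
[cite: GreenbergLNM1716, Thm. 1.5 (p. 61), Thm. 1.14 (p. 68), §2 (pp. 81–82)] [cite: MazurTateTeitelbaum1986Invent, §I.17] [cite: MazurRubin2004, Thm. 2.3.4]
[cite: SilvermanATAEC1994, Thm. V.5.3 and Exercise 5.11] [cite: CoatesSujatha2005, statement (A)] [cite: Lim2017FineSelmer, §3 Thm. 3.5]
[cite: Cassels1965ArithmeticVIII] [cite: SilvermanAEC2009, Thm. X.4.14] [cite: Miller2011LMS, Def. 1.1] -/
theorem additiveRankZeroAtTwo_of_residual_v12
    (hGZK : rank_eq_analyticRank_of_analyticRank_le_one) (hmod : hasEntireLFunction_rat) (hmodN : exists_isNewformOf)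
    (hLim2 : Lim2017.thm35_at_two_fineSelmerDual_moduleFinite_of_classicalMuVanishes_of_le_divisionField_four)
    (hFW : ferreroWashington1979_classicalMuVanishes)
    (hCassels : bsdRHS_eq_of_isIsogenous) (hCT : exists_casselsTate_pairing (K := ℚ))
    (h12 : Kato2004.thm12_4) (h114 : Greenberg1999_thm114_charIdeal_iota_invariant)
    (h114F : thm114_charIdeal_iota_invariant_splitMult_baseChange) (h15 : thm15_isTorsion_multiplicative_rat)
    (hDesc : Kato2004.exists_splitTwistDivisibilityInputsDescent_negOne_two)
    (hNST2 : Kato2004.rankZero_padicValNat_sha_add_padicValNat_tamagawa_le_at_two_of_noSplitTwistNegOneNegTwo_of_irreducible_of_fineSelmerDual_fg)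
    (hinS : Kato2004.exists_memberHullInputs_two_sharp_of_noSplitTwistNegOneNegTwo)
    (hS₁ : KatoDescentSocketAtTwoAdditiveNegOneSplitTwist) (hS₂ : KatoDescentSocketAtTwoAdditiveNegTwoSplitTwist)
    (hSR₁ : KatoDescentSocketAtTwoAdditiveNegOneSplitTwistReducible) (hSR₂ : KatoDescentSocketAtTwoAdditiveNegTwoSplitTwistReducible)
    (hAna : ∀ (W : WeierstrassCurve ℚ) [W.IsElliptic] [W.IsGloballyMinimal], ¬ W.HasCM → W.analyticRank = 0 →
      Addv W 2 → 0 ≤ padicValRat 2 W.j → ¬ IsAbelianGalois ℚ (W.divisionField 2) →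
      ∀ (κ : ZpExtension ℚ 2), κ.IsCyclotomic →
        ∃ (γ : Field.absoluteGaloisGroup ℚ) (D : W.FineSelmerDualData κ γ),
          Module.Finite ℤ_[2] (RestrictScalars ℤ_[2] (IwasawaAlgebra 2) D.X))
    (hLow : ∀ (W : WeierstrassCurve ℚ) [W.IsElliptic] [W.IsGloballyMinimal], ¬ W.HasCM → W.analyticRank = 0 →
      Addv W 2 → 0 ≤ padicValRat 2 W.j → MissingLowerBoundAt W 2)
    (hAnaMI : ∀ (W : WeierstrassCurve ℚ) [W.IsElliptic] [W.IsGloballyMinimal], ¬ W.HasCM → W.analyticRank = 0 →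
      Addv W 2 → padicValRat 2 W.j < 0 → W.HasIrreducibleModPGaloisRep 2 → ¬ IsAbelianGalois ℚ (W.divisionField 2) →
      ∀ (κ : ZpExtension ℚ 2), κ.IsCyclotomic →
        ∃ (γ : Field.absoluteGaloisGroup ℚ) (D : W.FineSelmerDualData κ γ),
          Module.Finite ℤ_[2] (RestrictScalars ℤ_[2] (IwasawaAlgebra 2) D.X))
    (hLowM : ∀ (W : WeierstrassCurve ℚ) [W.IsElliptic] [W.IsGloballyMinimal], ¬ W.HasCM → W.analyticRank = 0 →
      Addv W 2 → padicValRat 2 W.j < 0 → MissingLowerBoundAt W 2) :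
    Summit.BirchSwinnertonDyer.BirchSwinnertonDyer.Theses.ByReductionTypeAtTwo.AdditiveRankZeroAtTwo :=
  additiveRankZeroAtTwo_of_residual_v11 hGZK hmod hmodN hLim2 hFW hCassels hCT hNST2 hinS
    (katoSharpAtTwoAdditiveNegOneSplitTwist_of_socket hS₁ h12 hDesc h114 h114F h15 hmod)
    (katoSharpAtTwoAdditiveNegTwoSplitTwist_of_socket hS₂ h12 hDesc h114 h114F h15 hmod)
    (katoMemberSharpAtTwoAdditiveNegOneSplitTwistReducible_of_socket hSR₁ h12 hDesc h114 h114F h15 hmod)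
    (katoMemberSharpAtTwoAdditiveNegTwoSplitTwistReducible_of_socket hSR₂ h12 hDesc h114 h114F h15 hmod)
    hAna hLow hAnaMI hLowM

/-! ## §3 No hidden strengthening: v12's research binders from v11's; the children by name -/

/-- **v11's block targets give v12's sockets** (`…_of_target` ×4, `…AdditiveKatoDescentSocketDefs.lean` §3): v12 asks NOTHING beyond v11
except PRINT names (`h12`, `h114`, `h114F`, `h15`) and the review-accepted Literature construction fact `hDesc`, and asks LESS beyond print
(sockets instead of targets). Bookkeeping. [cite: Kato2004Asterisque, Conj. 12.10 (p. 224)] -/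
theorem sockets_of_targets_v12
    (h₁ : KatoSharpAtTwoAdditiveNegOneSplitTwist) (h₂ : KatoSharpAtTwoAdditiveNegTwoSplitTwist)
    (hR₁ : KatoMemberSharpAtTwoAdditiveNegOneSplitTwistReducible) (hR₂ : KatoMemberSharpAtTwoAdditiveNegTwoSplitTwistReducible) :
    KatoDescentSocketAtTwoAdditiveNegOneSplitTwist ∧ KatoDescentSocketAtTwoAdditiveNegTwoSplitTwist ∧
      KatoDescentSocketAtTwoAdditiveNegOneSplitTwistReducible ∧ KatoDescentSocketAtTwoAdditiveNegTwoSplitTwistReducible :=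
  ⟨katoDescentSocketAtTwoAdditiveNegOneSplitTwist_of_target h₁, katoDescentSocketAtTwoAdditiveNegTwoSplitTwist_of_target h₂,
    katoDescentSocketAtTwoAdditiveNegOneSplitTwistReducible_of_target hR₁,
    katoDescentSocketAtTwoAdditiveNegTwoSplitTwistReducible_of_target hR₂⟩

/-- **The glue item's shape, v12**: the executed children C1″ (`FineSelmerConjAAtTwoAdditivePotGood`), C3″ (`AdditivePotGoodLowerHalfAtTwo`)
BY NAME supply `hAna`/`hLow` verbatim (as in v11; C2″ and C4″ are NOT consumed). Pure logic.
[cite: CoatesSujatha2005, statement (A)] [cite: Miller2011LMS, Def. 1.1] -/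
theorem additiveRankZeroAtTwo_of_children_v12
    (hGZK : rank_eq_analyticRank_of_analyticRank_le_one) (hmod : hasEntireLFunction_rat) (hmodN : exists_isNewformOf)
    (hLim2 : Lim2017.thm35_at_two_fineSelmerDual_moduleFinite_of_classicalMuVanishes_of_le_divisionField_four)
    (hFW : ferreroWashington1979_classicalMuVanishes)
    (hCassels : bsdRHS_eq_of_isIsogenous) (hCT : exists_casselsTate_pairing (K := ℚ))
    (h12 : Kato2004.thm12_4) (h114 : Greenberg1999_thm114_charIdeal_iota_invariant)
    (h114F : thm114_charIdeal_iota_invariant_splitMult_baseChange) (h15 : thm15_isTorsion_multiplicative_rat)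
    (hDesc : Kato2004.exists_splitTwistDivisibilityInputsDescent_negOne_two)
    (hNST2 : Kato2004.rankZero_padicValNat_sha_add_padicValNat_tamagawa_le_at_two_of_noSplitTwistNegOneNegTwo_of_irreducible_of_fineSelmerDual_fg)
    (hinS : Kato2004.exists_memberHullInputs_two_sharp_of_noSplitTwistNegOneNegTwo)
    (hS₁ : KatoDescentSocketAtTwoAdditiveNegOneSplitTwist) (hS₂ : KatoDescentSocketAtTwoAdditiveNegTwoSplitTwist)
    (hSR₁ : KatoDescentSocketAtTwoAdditiveNegOneSplitTwistReducible) (hSR₂ : KatoDescentSocketAtTwoAdditiveNegTwoSplitTwistReducible)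
    (hC1 : FineSelmerConjAAtTwoAdditivePotGood) (hC3 : AdditivePotGoodLowerHalfAtTwo)
    (hAnaMI : ∀ (W : WeierstrassCurve ℚ) [W.IsElliptic] [W.IsGloballyMinimal], ¬ W.HasCM → W.analyticRank = 0 →
      Addv W 2 → padicValRat 2 W.j < 0 → W.HasIrreducibleModPGaloisRep 2 → ¬ IsAbelianGalois ℚ (W.divisionField 2) →
      ∀ (κ : ZpExtension ℚ 2), κ.IsCyclotomic →
        ∃ (γ : Field.absoluteGaloisGroup ℚ) (D : W.FineSelmerDualData κ γ),
          Module.Finite ℤ_[2] (RestrictScalars ℤ_[2] (IwasawaAlgebra 2) D.X))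
    (hLowM : ∀ (W : WeierstrassCurve ℚ) [W.IsElliptic] [W.IsGloballyMinimal], ¬ W.HasCM → W.analyticRank = 0 →
      Addv W 2 → padicValRat 2 W.j < 0 → MissingLowerBoundAt W 2) :
    Summit.BirchSwinnertonDyer.BirchSwinnertonDyer.Theses.ByReductionTypeAtTwo.AdditiveRankZeroAtTwo :=
  additiveRankZeroAtTwo_of_residual_v12 hGZK hmod hmodN hLim2 hFW hCassels hCT h12 h114 h114F h15 hDesc hNST2 hinS hS₁ hS₂ hSR₁ hSR₂
    (fun W _ _ hcm hr hadd hj hab => hC1 W hcm hr hadd hj hab) (fun W _ _ hcm hr hadd hj => hC3 W hcm hr hadd hj) hAnaMI hLowM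

end Summit.BirchSwinnertonDyer.BirchSwinnertonDyer.Theorems.AddKatoTwo

end
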